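import Summits.AtomisticToContinuum.Crystallization.Theorems.OverbindingBudgetMisfitRegistration

/-!
# OverbindingBudget — «MisfitWindow», part 1/3: the WINDOWED census statements, kernel arrows, rim packing and the packing seam
(decomp-a2c lens-4, generation 39)

Helper file (`--supports stmt-AtomisticToContinuum-31280`); imports only the g38 node `…OverbindingBudgetMisfitRegistration`.  Part 2
(`…MisfitWindowLayer`) proves that the off-window sites of a chunk lie in its boundary layer; part 3 (`…MisfitWindow`) re-proves the glue
with the off-window rebate absorbed and records the cones.

THE EXTREMAL OBSERVATION (lens «minimal counterexample»).  Beneath the leaf of record SEG = `ScaleEnergyGap (122/125) 0` the g38 node reads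
`SEG ⟸ TwoShellShape ∧ RegisteredScaleGap ∧ NearChargeGap (33/2)`, with the rim piece NCG UNDECIDED: at ONE length scale the charge-free
sites within `R·nn` of a charged site number `≤ K(R)` per charge (packing), so a counterexample to NCG must NEST charge-free matter at many
dyadic scales around one charge.  But the ONLY configurations the glue `misfitRelax_of_misfitEnergyGap` ever feeds to a census are CHUNKS
`Y ∩ cube` of a `δ`-discrete, `9/10`-covering texture `Y`: every chunk site has `nn ≥ min δ 2`, every chunk site two units inside the cube has
`nn ≤ 19/10` (the covering witness of `y_i + e₀`), and the boundary layer of width two holds `≤ 54 (4/δ' + 1) δ'⁻² · ℓ²` sites — `o(ℓ³)`.  The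
extremal configurations of the undecided leaf therefore lie OUTSIDE the cone's domain of use, and the window belongs in the STATEMENT of the
census as a rebate:

    ScaleEnergyGapW a s σ₁ σ₂ :  ∃ c > 0, C,  N e⋆ + c·#scale-bad − C·#charged − C·#{i : nn_i ∉ [σ₁, σ₂]} − C·N^(2/3) ≤ E(y)   (all injective y)
    TameScaleGap a s          :  ∀ δ ∈ (0, 2],  ScaleEnergyGapW a s δ 2          (likewise `MisfitEnergyGapW`, `GapEnergyGapW`, `TameMisfitGap`).

THIS PART proves (all seams, no energy input):

    TameMisfitGap a 0  ⟸  TameScaleGap a 0 ∧ GapFreeShells          TameMisfitGap a s ⟸ TameScaleGap a s ∧ GapEnergyGap a s          (§C)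
    ScaleEnergyGapW a s σ₁ σ₂  ⟸  TwoShellShape (1/100) ε g ∧ RegisteredScaleGap a s ρ ε g        (EVERY 0 < σ₁ ≤ σ₂, ρ ≥ 0 — §E, PURE PACKING)
    TameScaleGap a s  ⟸  TwoShellShape (1/100) ε g ∧ RegisteredScaleGap a s ρ ε g                                        (`tameScaleGap_of_registered`)

§E is potential-free bookkeeping: a scale-bad site is deeply registered (priced by RSG), or near charge at radius `R = 7ρ/2 + 5/2`
(`nearCharge_of_not_deepReg`) and then either off-window (rebated) or in-window — and in-window near-charge sites are `σ₁`-separated points of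
the cube of side `2Rσ₂ + σ₁` about their charge, at most `27 (2Rσ₂ + σ₁)³/σ₁³` per charged site (`card_le_of_cube`, §D); RSG's unregistered
rebate is charged + charge-free-unframed, the latter near charge at radius `5/2` (`nearCharge_of_not_framed`) — in-window ones packed, off-window
ones rebated.  KERNEL ARROWS (§C): `MEG ⇒ MEG_W ⇒ TameMisfitGap`, `SEG ⇒ SEG_W ⇒ TameScaleGap`; `NearChargeGap` is not used anywhere.
Reference-free; nothing at margin `2`; axioms `propext`, `Classical.choice`, `Quot.sound` only.
-/

namespace Summit.AtomisticToContinuum.Crystallization.Theorems.OverbindingBudgetMisfitWindowStatements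

open Filter Metric Set Topology
open scoped BigOperators
open Literature.MathematicalPhysics.StatisticalMechanics
open Literature.Geometry.DiscreteGeometry (IsChargeFree bondGraph nearestDist nearestDist_le_dist nearestDist_nonneg le_nearestDist bondGraph_adj)
open Summit.AtomisticToContinuum.Crystallization.Theses.OverbindingBudget (RobustDefectLimitWindows)
open Summit.AtomisticToContinuum.Crystallization.Theses.PricedLinkCensus (ChargedEnergyGap)
open Summit.AtomisticToContinuum.Crystallization.Theorems.OverbindingBudgetCubeTails (card_le_of_separated_of_box)
open Summit.AtomisticToContinuum.Crystallization.Theorems.OverbindingBudgetGradedBareness (CleanlessExcessT)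
open Summit.AtomisticToContinuum.Crystallization.Theorems.OverbindingBudgetCoherentCut (CoherentResidual)
open Summit.AtomisticToContinuum.Crystallization.Theorems.OverbindingBudgetViolatorDensityFloor (RT)
open Summit.AtomisticToContinuum.Crystallization.Theorems.OverbindingBudgetRecurrentDustStatements (ViolatorsL rt_mono window_finite
  window_finite_lt)
open Summit.AtomisticToContinuum.Crystallization.Theorems.OverbindingBudgetBindingSignLaw (grid_lower_bound)
open Summit.AtomisticToContinuum.Crystallization.Theorems.OverbindingBudgetExcessInstability (finite_inter_cube)
open Summit.AtomisticToContinuum.Crystallization.Theorems.OverbindingBudgetEdgeRelaxationStatements (CleanClass StrainedCubes)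
open Summit.AtomisticToContinuum.Crystallization.Theorems.OverbindingBudgetElasticSplitStatements (chargedCount DenseCharge SparseCharge)
open Summit.AtomisticToContinuum.Crystallization.Theorems.OverbindingBudgetElasticSplitPricing (rpow_two_thirds_le
  two_mul_interactionEnergy_eq_sum_sum_image groundStateEnergy_le_eventually)
open Summit.AtomisticToContinuum.Crystallization.Theorems.OverbindingBudgetGrossMargin (GrossLiouvilleLaw)
open Summit.AtomisticToContinuum.Crystallization.Theorems.OverbindingBudgetMisfitCensusStatements (Bad Short Long Gap badCount scaleCount
  gapCount MisfitEnergyGap ScaleEnergyGap GapEnergyGap GapFreeShells bad_cases badCount_le_scaleCount_add_gapCount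
  badCount_le_scaleCount_of_gapFree rt_of_local card_le_of_cube MisfitRelax)
open Summit.AtomisticToContinuum.Crystallization.Theorems.OverbindingBudgetMisfitCensus (rdef_of_ceg_misfitRelax
  grossLiouvilleLaw_of_misfitRelax)
open Summit.AtomisticToContinuum.Crystallization.Theorems.OverbindingBudgetMisfitRegistration (Framed Reg DeepReg NearCharge regScaleCount
  unregCount nearChargeCount RegisteredScaleGap NearChargeGap nearCharge_of_not_framed nearCharge_of_not_deepReg)
open Summit.AtomisticToContinuum.Crystallization.Theorems.OverbindingBudgetTwoShellShape (TwoShellShape)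

variable {N : ℕ}

/-! ## §A  The scale window of a finite configuration -/

/-- `InWindow σ₁ σ₂ y i`: the own nearest-neighbour distance of the site `i` lies in `[σ₁, σ₂]`. -/
def InWindow (σ₁ σ₂ : ℝ) (y : Fin N → EuclideanSpace ℝ (Fin 3)) (i : Fin N) : Prop :=
  σ₁ ≤ nearestDist y i ∧ nearestDist y i ≤ σ₂

/-- The number of OFF-WINDOW sites (`nn_i ∉ [σ₁, σ₂]`). -/
noncomputable def offCount (σ₁ σ₂ : ℝ) (y : Fin N → EuclideanSpace ℝ (Fin 3)) : ℕ :=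
  Nat.card {i : Fin N // ¬ InWindow σ₁ σ₂ y i}

/-- The number of IN-WINDOW sites having a `(1/100)`-charged site within `R·nn` (the windowed defect rim). -/
noncomputable def rimCount (σ₁ σ₂ R : ℝ) (y : Fin N → EuclideanSpace ℝ (Fin 3)) : ℕ :=
  Nat.card {i : Fin N // InWindow σ₁ σ₂ y i ∧ NearCharge R y i}

/-! ## §B  The windowed census statements -/

/-- **`ScaleEnergyGapW a s σ₁ σ₂` («SEG_W»)** — `ScaleEnergyGap a s` with an extra rebate `C` per off-window site: uniformly in `N`, an injective
configuration pays `c > 0` per scale-bad (SHORT/LONG) site above `N e⋆`, up to `C` per charged site, `C` per site whose own nearest-neighbour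
distance lies outside `[σ₁, σ₂]`, and the surface term.  KERNEL-WEAKER than SEG. -/
def ScaleEnergyGapW (a s σ₁ σ₂ : ℝ) : Prop :=
  ∃ c C : ℝ, 0 < c ∧ ∀ (N : ℕ) (y : Fin N → EuclideanSpace ℝ (Fin 3)), Function.Injective y →
    (N : ℝ) * (⨅ Q : PeriodicConfiguration 3, Q.energyPerParticle lennardJones) + c * (scaleCount a s y : ℝ)
      - C * (chargedCount y : ℝ) - C * (offCount σ₁ σ₂ y : ℝ) - C * (N : ℝ) ^ (2 / 3 : ℝ) ≤ interactionEnergy lennardJones y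

/-- **`MisfitEnergyGapW a s σ₁ σ₂` («MEG_W»)** — `MisfitEnergyGap a s` with the off-window rebate.  KERNEL-WEAKER than MEG. -/
def MisfitEnergyGapW (a s σ₁ σ₂ : ℝ) : Prop :=
  ∃ c C : ℝ, 0 < c ∧ ∀ (N : ℕ) (y : Fin N → EuclideanSpace ℝ (Fin 3)), Function.Injective y →
    (N : ℝ) * (⨅ Q : PeriodicConfiguration 3, Q.energyPerParticle lennardJones) + c * (badCount a s y : ℝ)
      - C * (chargedCount y : ℝ) - C * (offCount σ₁ σ₂ y : ℝ) - C * (N : ℝ) ^ (2 / 3 : ℝ) ≤ interactionEnergy lennardJones y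

/-- **`GapEnergyGapW a s σ₁ σ₂` («GEG_W»)** — `GapEnergyGap a s` with the off-window rebate.  KERNEL-WEAKER than GEG. -/
def GapEnergyGapW (a s σ₁ σ₂ : ℝ) : Prop :=
  ∃ c C : ℝ, 0 < c ∧ ∀ (N : ℕ) (y : Fin N → EuclideanSpace ℝ (Fin 3)), Function.Injective y →
    (N : ℝ) * (⨅ Q : PeriodicConfiguration 3, Q.energyPerParticle lennardJones) + c * (gapCount a s y : ℝ)
      - C * (chargedCount y : ℝ) - C * (offCount σ₁ σ₂ y : ℝ) - C * (N : ℝ) ^ (2 / 3 : ℝ) ≤ interactionEnergy lennardJones y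

/-- **`TameScaleGap a s` («TSG»)** — the scale census on TAME configurations: `ScaleEnergyGapW a s δ 2` for every window `[δ, 2]`, `0 < δ ≤ 2`
(constants may depend on `δ`).  This is all the glue ever uses. -/
def TameScaleGap (a s : ℝ) : Prop :=
  ∀ δ : ℝ, 0 < δ → δ ≤ 2 → ScaleEnergyGapW a s δ 2

/-- **`TameMisfitGap a s` («TMG»)** — the misfit census on tame configurations: `MisfitEnergyGapW a s δ 2` for every `0 < δ ≤ 2`. -/
def TameMisfitGap (a s : ℝ) : Prop :=
  ∀ δ : ℝ, 0 < δ → δ ≤ 2 → MisfitEnergyGapW a s δ 2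

/-! ## §C  Kernel arrows (PROVED): the windowed statements are weaker -/

/-- SEG ⇒ SEG_W (any window). [this file] -/
theorem scaleEnergyGapW_of_scaleEnergyGap {a s : ℝ} (σ₁ σ₂ : ℝ) (h : ScaleEnergyGap a s) : ScaleEnergyGapW a s σ₁ σ₂ := by
  obtain ⟨c, C, hc, hS⟩ := h
  refine ⟨c, max C 0, hc, fun N y hy => ?_⟩
  have e := hS N y hy
  have hC0 : 0 ≤ max C 0 := le_max_right _ _
  have hCle : C ≤ max C 0 := le_max_left _ _
  have hm0 : (0 : ℝ) ≤ chargedCount y := Nat.cast_nonneg _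
  have ho0 : (0 : ℝ) ≤ offCount σ₁ σ₂ y := Nat.cast_nonneg _
  have hN23 : (0 : ℝ) ≤ (N : ℝ) ^ (2 / 3 : ℝ) := Real.rpow_nonneg (Nat.cast_nonneg _) _
  nlinarith [mul_nonneg hC0 ho0, mul_nonneg (sub_nonneg.2 hCle) hm0, mul_nonneg (sub_nonneg.2 hCle) hN23]

/-- MEG ⇒ MEG_W (any window). [this file] -/
theorem misfitEnergyGapW_of_misfitEnergyGap {a s : ℝ} (σ₁ σ₂ : ℝ) (h : MisfitEnergyGap a s) : MisfitEnergyGapW a s σ₁ σ₂ := by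
  obtain ⟨c, C, hc, hM⟩ := h
  refine ⟨c, max C 0, hc, fun N y hy => ?_⟩
  have e := hM N y hy
  have hC0 : 0 ≤ max C 0 := le_max_right _ _
  have hCle : C ≤ max C 0 := le_max_left _ _
  have hm0 : (0 : ℝ) ≤ chargedCount y := Nat.cast_nonneg _
  have ho0 : (0 : ℝ) ≤ offCount σ₁ σ₂ y := Nat.cast_nonneg _
  have hN23 : (0 : ℝ) ≤ (N : ℝ) ^ (2 / 3 : ℝ) := Real.rpow_nonneg (Nat.cast_nonneg _) _
  nlinarith [mul_nonneg hC0 ho0, mul_nonneg (sub_nonneg.2 hCle) hm0, mul_nonneg (sub_nonneg.2 hCle) hN23]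

/-- GEG ⇒ GEG_W (any window). [this file] -/
theorem gapEnergyGapW_of_gapEnergyGap {a s : ℝ} (σ₁ σ₂ : ℝ) (h : GapEnergyGap a s) : GapEnergyGapW a s σ₁ σ₂ := by
  obtain ⟨c, C, hc, hG⟩ := h
  refine ⟨c, max C 0, hc, fun N y hy => ?_⟩
  have e := hG N y hy
  have hC0 : 0 ≤ max C 0 := le_max_right _ _
  have hCle : C ≤ max C 0 := le_max_left _ _
  have hm0 : (0 : ℝ) ≤ chargedCount y := Nat.cast_nonneg _
  have ho0 : (0 : ℝ) ≤ offCount σ₁ σ₂ y := Nat.cast_nonneg _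
  have hN23 : (0 : ℝ) ≤ (N : ℝ) ^ (2 / 3 : ℝ) := Real.rpow_nonneg (Nat.cast_nonneg _) _
  nlinarith [mul_nonneg hC0 ho0, mul_nonneg (sub_nonneg.2 hCle) hm0, mul_nonneg (sub_nonneg.2 hCle) hN23]

/-- SEG ⇒ TSG. [this file] -/
theorem tameScaleGap_of_scaleEnergyGap {a s : ℝ} (h : ScaleEnergyGap a s) : TameScaleGap a s :=
  fun δ _ _ => scaleEnergyGapW_of_scaleEnergyGap δ 2 h

/-- MEG ⇒ TMG. [this file] -/
theorem tameMisfitGap_of_misfitEnergyGap {a s : ℝ} (h : MisfitEnergyGap a s) : TameMisfitGap a s :=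
  fun δ _ _ => misfitEnergyGapW_of_misfitEnergyGap δ 2 h

/-- **MEG_W from its two pieces** (averaging over the partition `Bad ⊆ Scale ∪ Gap`). [this file] -/
theorem misfitEnergyGapW_of_scale_gap {a s σ₁ σ₂ : ℝ} (hS : ScaleEnergyGapW a s σ₁ σ₂) (hG : GapEnergyGapW a s σ₁ σ₂) :
    MisfitEnergyGapW a s σ₁ σ₂ := by
  obtain ⟨c₁, C₁, hc₁, h₁⟩ := hS
  obtain ⟨c₂, C₂, hc₂, h₂⟩ := hG
  refine ⟨min c₁ c₂ / 2, (C₁ + C₂) / 2, by positivity, fun N y hy => ?_⟩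
  have e₁ := h₁ N y hy
  have e₂ := h₂ N y hy
  have hb : (badCount a s y : ℝ) ≤ (scaleCount a s y : ℝ) + (gapCount a s y : ℝ) := by
    exact_mod_cast badCount_le_scaleCount_add_gapCount hy
  have hm0 : 0 ≤ min c₁ c₂ := le_min hc₁.le hc₂.le
  have hsc0 : (0 : ℝ) ≤ scaleCount a s y := Nat.cast_nonneg _
  have hgc0 : (0 : ℝ) ≤ gapCount a s y := Nat.cast_nonneg _
  have h3 : min c₁ c₂ * (badCount a s y : ℝ) ≤ min c₁ c₂ * ((scaleCount a s y : ℝ) + gapCount a s y) :=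
    mul_le_mul_of_nonneg_left hb hm0
  have h4 : min c₁ c₂ * (scaleCount a s y : ℝ) ≤ c₁ * scaleCount a s y := mul_le_mul_of_nonneg_right (min_le_left _ _) hsc0
  have h5 : min c₁ c₂ * (gapCount a s y : ℝ) ≤ c₂ * gapCount a s y := mul_le_mul_of_nonneg_right (min_le_right _ _) hgc0
  nlinarith

/-- **MEG_W at margin `0` from SEG_W and gap-free shells** (`#bad ≤ #scale` there). [this file] -/
theorem misfitEnergyGapW_zero_of_scale_gapFree {a σ₁ σ₂ : ℝ} (hS : ScaleEnergyGapW a 0 σ₁ σ₂) (hGF : GapFreeShells) :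
    MisfitEnergyGapW a 0 σ₁ σ₂ := by
  obtain ⟨c, C, hc, h⟩ := hS
  refine ⟨c, C, hc, fun N y hy => ?_⟩
  have hle : (badCount a 0 y : ℝ) ≤ scaleCount a 0 y := by exact_mod_cast badCount_le_scaleCount_of_gapFree hGF hy
  have := h N y hy
  nlinarith

/-- TMG from TSG and the windowed gap census family. [this file] -/
theorem tameMisfitGap_of_tameScale_gapW {a s : ℝ} (hS : TameScaleGap a s) (hG : ∀ δ : ℝ, 0 < δ → δ ≤ 2 → GapEnergyGapW a s δ 2) :
    TameMisfitGap a s :=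
  fun δ hδ hδ2 => misfitEnergyGapW_of_scale_gap (hS δ hδ hδ2) (hG δ hδ hδ2)

/-- TMG from TSG and GEG. [this file] -/
theorem tameMisfitGap_of_tameScale_gap {a s : ℝ} (hS : TameScaleGap a s) (hG : GapEnergyGap a s) : TameMisfitGap a s :=
  tameMisfitGap_of_tameScale_gapW hS (fun δ _ _ => gapEnergyGapW_of_gapEnergyGap δ 2 hG)

/-- TMG at margin `0` from TSG and gap-free shells. [this file] -/
theorem tameMisfitGap_zero_of_tameScale_gapFree {a : ℝ} (hS : TameScaleGap a 0) (hGF : GapFreeShells) : TameMisfitGap a 0 :=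
  fun δ hδ hδ2 => misfitEnergyGapW_zero_of_scale_gapFree (hS δ hδ hδ2) hGF

/-! ## §D  Packing of the windowed rim (PROVED) -/

/-- **The windowed rim is packed: `#rim ≤ 27 (2Rσ₂ + σ₁)³/σ₁³ · #charged`.**  In-window sites near a charged site `j` at radius `R·nn ≤ R σ₂` are
`σ₁`-separated points of the cube of side `2Rσ₂ + σ₁` about `y j`. [this file] -/
theorem rimCount_le {σ₁ σ₂ R : ℝ} (hσ : 0 < σ₁) (hσσ : σ₁ ≤ σ₂) (hR : 0 ≤ R) {y : Fin N → EuclideanSpace ℝ (Fin 3)}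
    (hy : Function.Injective y) : (rimCount σ₁ σ₂ R y : ℝ) ≤ 27 / σ₁ ^ 3 * (2 * R * σ₂ + σ₁) ^ 3 * chargedCount y := by
  classical
  set K : ℝ := 27 / σ₁ ^ 3 * (2 * R * σ₂ + σ₁) ^ 3 with hK
  set S : Finset (Fin N) := Finset.univ.filter (fun i => InWindow σ₁ σ₂ y i ∧ NearCharge R y i) with hS
  set Ch : Finset (Fin N) := Finset.univ.filter (fun j => ¬ IsChargeFree (1 / 100 : ℝ) y j) with hCh
  have hSc : rimCount σ₁ σ₂ R y = S.card := by
    rw [rimCount, Nat.card_eq_fintype_card, Fintype.card_subtype]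
  have hChc : chargedCount y = Ch.card := by
    rw [chargedCount, Nat.card_eq_fintype_card, Fintype.card_subtype]
  set T : Fin N → Finset (Fin N) := fun j => S.filter (fun i => dist (y i) (y j) ≤ R * σ₂) with hT
  have hRσ : 0 ≤ R * σ₂ := mul_nonneg hR (by linarith)
  have hcover : S ⊆ Ch.biUnion T := by
    intro i hi
    have hi' := (Finset.mem_filter.1 hi).2
    obtain ⟨⟨-, hhi⟩, j, hj, hd⟩ := hi'
    rw [Finset.mem_biUnion]
    refine ⟨j, Finset.mem_filter.2 ⟨Finset.mem_univ _, hj⟩, Finset.mem_filter.2 ⟨hi, ?_⟩⟩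
    rw [dist_comm]
    exact hd.trans (mul_le_mul_of_nonneg_left hhi hR)
  have hfib : ∀ j : Fin N, ((T j).card : ℝ) ≤ K := by
    intro j
    have hcardim : ((T j).image y).card = (T j).card := Finset.card_image_of_injective _ hy
    set o : EuclideanSpace ℝ (Fin 3) := WithLp.toLp 2 (fun k : Fin 3 => (y j) k - R * σ₂) with ho
    have hok : ∀ k : Fin 3, o k = (y j) k - R * σ₂ := fun k => rfl
    have hmem : ∀ z ∈ (T j).image y, ∀ k : Fin 3, o k ≤ z k ∧ z k < o k + (2 * R * σ₂ + σ₁) := by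
      intro z hz k
      rw [Finset.mem_image] at hz
      obtain ⟨i, hi, rfl⟩ := hz
      have hd : dist (y i) (y j) ≤ R * σ₂ := (Finset.mem_filter.1 hi).2
      have hk : |(y i) k - (y j) k| ≤ dist (y i) (y j) := by
        rw [← Real.dist_eq]
        exact PiLp.dist_apply_le (y i) (y j) k
      have habs := abs_le.1 (hk.trans hd)
      rw [hok]
      constructor <;> linarith [habs.1, habs.2]
    have hsep : ∀ z ∈ (T j).image y, ∀ w ∈ (T j).image y, z ≠ w → σ₁ ≤ dist z w := by
      intro z hz w hw hzw
      rw [Finset.mem_image] at hz hw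
      obtain ⟨i, hi, rfl⟩ := hz
      obtain ⟨i', hi', rfl⟩ := hw
      have hii : i' ≠ i := fun h => hzw (by rw [h])
      have hwin : InWindow σ₁ σ₂ y i := ((Finset.mem_filter.1 (Finset.mem_filter.1 hi).1).2).1
      exact hwin.1.trans (nearestDist_le_dist y hii)
    have h := card_le_of_cube (F := (T j).image y) (o := o) hσ (by nlinarith) hmem hsep
    rw [hcardim] at h
    rw [hK]
    exact h
  have h1 : S.card ≤ (Ch.biUnion T).card := Finset.card_le_card hcover
  have h2 : (Ch.biUnion T).card ≤ ∑ j ∈ Ch, (T j).card := Finset.card_biUnion_le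
  have h3 : (∑ j ∈ Ch, ((T j).card : ℝ)) ≤ ∑ j ∈ Ch, K := Finset.sum_le_sum (fun j _ => hfib j)
  rw [Finset.sum_const, nsmul_eq_mul] at h3
  have h12 : (S.card : ℝ) ≤ ∑ j ∈ Ch, ((T j).card : ℝ) := by exact_mod_cast h1.trans h2
  calc (rimCount σ₁ σ₂ R y : ℝ) = S.card := by rw [hSc]
    _ ≤ Ch.card * K := h12.trans h3
    _ = K * chargedCount y := by rw [hChc]; ring

/-! ## §E  The packing seam: SEG_W from the shape slot and RSG (PROVED) -/

/-- `#scale-bad ≤ #registered-scale-bad + #windowed-rim(7ρ/2 + 5/2) + #off-window`. [this file] -/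
theorem scaleCount_le_reg_rim_off {a s ρ ε g σ₁ σ₂ : ℝ} (hρ : 0 ≤ ρ) (hT : TwoShellShape (1 / 100) ε g)
    {y : Fin N → EuclideanSpace ℝ (Fin 3)} (hy : Function.Injective y) :
    scaleCount a s y ≤ regScaleCount a s ρ ε g y + rimCount σ₁ σ₂ (7 * ρ / 2 + 5 / 2) y + offCount σ₁ σ₂ y := by
  classical
  simp only [scaleCount, regScaleCount, rimCount, offCount, Nat.card_eq_fintype_card, Fintype.card_subtype]
  calc (Finset.univ.filter fun i => Bad a s y i ∧ (Short a s y i ∨ Long a s y i)).card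
      ≤ (((Finset.univ.filter fun i => (Bad a s y i ∧ (Short a s y i ∨ Long a s y i)) ∧ DeepReg ρ ε g y i) ∪
          (Finset.univ.filter fun i => InWindow σ₁ σ₂ y i ∧ NearCharge (7 * ρ / 2 + 5 / 2) y i)) ∪
          (Finset.univ.filter fun i => ¬ InWindow σ₁ σ₂ y i)).card := by
        apply Finset.card_le_card
        intro i hi
        rw [Finset.mem_filter] at hi
        rw [Finset.mem_union, Finset.mem_union, Finset.mem_filter, Finset.mem_filter, Finset.mem_filter]
        by_cases hD : DeepReg ρ ε g y i
        · exact Or.inl (Or.inl ⟨hi.1, hi.2, hD⟩)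
        · by_cases hW : InWindow σ₁ σ₂ y i
          · exact Or.inl (Or.inr ⟨hi.1, hW, nearCharge_of_not_deepReg hρ hT hy hD⟩)
          · exact Or.inr ⟨hi.1, hW⟩
    _ ≤ _ := (Finset.card_union_le _ _).trans (by gcongr; exact Finset.card_union_le _ _)

/-- `#unregistered ≤ #charged + #windowed-rim(R) + #off-window` (`R ≥ 5/2`). [this file] -/
theorem unregCount_le_ch_rim_off {ε g σ₁ σ₂ R : ℝ} (hR : 5 / 2 ≤ R) (hT : TwoShellShape (1 / 100) ε g)
    {y : Fin N → EuclideanSpace ℝ (Fin 3)} (hy : Function.Injective y) :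
    unregCount ε g y ≤ chargedCount y + rimCount σ₁ σ₂ R y + offCount σ₁ σ₂ y := by
  classical
  simp only [unregCount, chargedCount, rimCount, offCount, Nat.card_eq_fintype_card, Fintype.card_subtype]
  calc (Finset.univ.filter fun i => ¬ Reg ε g y i).card
      ≤ (((Finset.univ.filter fun i => ¬ IsChargeFree (1 / 100 : ℝ) y i) ∪
          (Finset.univ.filter fun i => InWindow σ₁ σ₂ y i ∧ NearCharge R y i)) ∪
          (Finset.univ.filter fun i => ¬ InWindow σ₁ σ₂ y i)).card := by
        apply Finset.card_le_card
        intro i hi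
        rw [Finset.mem_filter] at hi
        rw [Finset.mem_union, Finset.mem_union, Finset.mem_filter, Finset.mem_filter, Finset.mem_filter]
        by_cases hc : IsChargeFree (1 / 100 : ℝ) y i
        · have hnf : ¬ Framed ε g y i := fun hf => hi.2 ⟨hc, hf⟩
          by_cases hW : InWindow σ₁ σ₂ y i
          · exact Or.inl (Or.inr ⟨hi.1, hW, (nearCharge_of_not_framed hT hy hnf).mono hR⟩)
          · exact Or.inr ⟨hi.1, hW⟩
        · exact Or.inl (Or.inl ⟨hi.1, hc⟩)
    _ ≤ _ := (Finset.card_union_le _ _).trans (by gcongr; exact Finset.card_union_le _ _)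

/-- **THE PACKING SEAM.  `TwoShellShape (1/100) ε g → RegisteredScaleGap a s ρ ε g → ScaleEnergyGapW a s σ₁ σ₂`** for every window
`0 < σ₁ ≤ σ₂` and every `ρ ≥ 0`: a scale-bad site is deeply registered (priced `c₁` by RSG), or in the windowed rim (at most
`K = 27 (2Rσ₂ + σ₁)³/σ₁³` per charged site, `R = 7ρ/2 + 5/2`), or off-window (rebated); RSG's unregistered rebate is bounded the same way.
Constants: `c = c₁`, `C = C₁⁺ + c₁ + (C₁⁺ + c₁) K`.  No energy input. [this file] -/
theorem scaleEnergyGapW_of_registered {a s ρ ε g σ₁ σ₂ : ℝ} (hρ : 0 ≤ ρ) (hσ : 0 < σ₁) (hσσ : σ₁ ≤ σ₂)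
    (hT : TwoShellShape (1 / 100) ε g) (hR : RegisteredScaleGap a s ρ ε g) : ScaleEnergyGapW a s σ₁ σ₂ := by
  obtain ⟨c₁, C₁, hc₁, h₁⟩ := hR
  set D₁ : ℝ := max C₁ 0 with hD₁
  have hD₁0 : 0 ≤ D₁ := le_max_right _ _
  have hC₁le : C₁ ≤ D₁ := le_max_left _ _
  set R : ℝ := 7 * ρ / 2 + 5 / 2 with hRdef
  have hR0 : 0 ≤ R := by rw [hRdef]; positivity
  have hR52 : 5 / 2 ≤ R := by rw [hRdef]; linarith
  set K : ℝ := 27 / σ₁ ^ 3 * (2 * R * σ₂ + σ₁) ^ 3 with hK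
  have hK0 : 0 ≤ K := by
    rw [hK]
    have : 0 ≤ 2 * R * σ₂ + σ₁ := by nlinarith
    positivity
  refine ⟨c₁, D₁ + c₁ + (D₁ + c₁) * K, hc₁, fun N y hy => ?_⟩
  have e₁ := h₁ N y hy
  have hS : (scaleCount a s y : ℝ) ≤ regScaleCount a s ρ ε g y + rimCount σ₁ σ₂ R y + offCount σ₁ σ₂ y := by
    exact_mod_cast scaleCount_le_reg_rim_off hρ hT hy
  have hU : (unregCount ε g y : ℝ) ≤ chargedCount y + rimCount σ₁ σ₂ R y + offCount σ₁ σ₂ y := by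
    exact_mod_cast unregCount_le_ch_rim_off hR52 hT hy
  have hP : (rimCount σ₁ σ₂ R y : ℝ) ≤ K * chargedCount y := by
    have := rimCount_le hσ hσσ hR0 hy (R := R)
    rw [hK]
    exact this
  have hA0 : (0 : ℝ) ≤ regScaleCount a s ρ ε g y := Nat.cast_nonneg _
  have hB0 : (0 : ℝ) ≤ rimCount σ₁ σ₂ R y := Nat.cast_nonneg _
  have hU0 : (0 : ℝ) ≤ unregCount ε g y := Nat.cast_nonneg _
  have hm0 : (0 : ℝ) ≤ chargedCount y := Nat.cast_nonneg _
  have ho0 : (0 : ℝ) ≤ offCount σ₁ σ₂ y := Nat.cast_nonneg _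
  have hsc0 : (0 : ℝ) ≤ scaleCount a s y := Nat.cast_nonneg _
  have hN23 : (0 : ℝ) ≤ (N : ℝ) ^ (2 / 3 : ℝ) := Real.rpow_nonneg (Nat.cast_nonneg _) _
  -- (α) with nonnegative rebate
  have e₁' : (N : ℝ) * (⨅ Q : PeriodicConfiguration 3, Q.energyPerParticle lennardJones) + c₁ * (regScaleCount a s ρ ε g y : ℝ)
      - D₁ * (unregCount ε g y : ℝ) - D₁ * (N : ℝ) ^ (2 / 3 : ℝ) ≤ interactionEnergy lennardJones y := by
    nlinarith [mul_nonneg (sub_nonneg.2 hC₁le) hU0, mul_nonneg (sub_nonneg.2 hC₁le) hN23]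
  have f1 := mul_le_mul_of_nonneg_left hS hc₁.le
  have f2 := mul_le_mul_of_nonneg_left hU hD₁0
  have f3 := mul_le_mul_of_nonneg_left hP (by positivity : (0 : ℝ) ≤ D₁ + c₁)
  nlinarith [mul_nonneg hc₁.le hm0, mul_nonneg (mul_nonneg (by positivity : (0 : ℝ) ≤ D₁ + c₁) hK0) ho0,
    mul_nonneg (by positivity : (0 : ℝ) ≤ c₁ + (D₁ + c₁) * K) hN23]

/-- **TSG from the shape slot and RSG** (`ρ ≥ 0`): the window `[δ, 2]` instance. [this file] -/
theorem tameScaleGap_of_registered {a s ρ ε g : ℝ} (hρ : 0 ≤ ρ) (hT : TwoShellShape (1 / 100) ε g) (hR : RegisteredScaleGap a s ρ ε g) :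
    TameScaleGap a s :=
  fun _ hδ hδ2 => scaleEnergyGapW_of_registered hρ hδ hδ2 hT hR

end Summit.AtomisticToContinuum.Crystallization.Theorems.OverbindingBudgetMisfitWindowStatements
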